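import Literature.Geometry.Lorentzian.CoordScalarCurvatureEvolution
import HarnessLib

/-!
# Second covariant derivatives of the curvature in coordinates: the Ricci identities and the
differentiated Bianchi identity

Fifth layer of the coordinate tensor calculus (`CoordCurvature`, `CoordBianchi`,
`CoordMetricVariation`, `CoordScalarCurvatureEvolution`): metric components
`G : E → (E →L E →L ℝ)`, smooth, symmetric and nondegenerate on an open set `V` of a
finite-dimensional real normed space `E` (`IsMetricOn G V`), Christoffel map `Γ = chrAt G`,
curvature endomorphism `R(X,Y) = riemAt G x X Y ∈ End E`, Ricci form `Ric = ricAt G`, covariant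
derivatives along constant fields `cov₂At` (fields of bilinear forms) and `covRiemAt` (`∇R`).
Here we add the **second order** of this calculus, which is the static input of the evolution
equation of the curvature tensor under the Ricci flow (Topping 2006, Prop. 2.4.1 and 2.5.1;
Hamilton 1982, Lemma 7.2 and Thm. 7.1):

* `riemCLM G x` — the curvature endomorphism bundled as a continuous bilinear map
  `E →L E →L End E` (so that fields `y ↦ R_y(c(y), V)` can be differentiated by the chain rule);
* `cov₃At G τ x` — the covariant derivative `(∇_W τ)(A,B,C)` of a field of trilinear forms, with
  its linearity and its compatibility with permutations of the slots; in particular the **second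
  covariant derivative of a field of bilinear forms** `(∇²_{X,A} β)(B,C) = cov₃At G (cov₂At G β) x X A B C`
  (`∇²_{X,A} = ∇_X ∇_A − ∇_{∇_X A}`; Topping 2006, §2.1);
* `cov2RiemAt G x X U Y V` — the **second covariant derivative of the curvature endomorphism**
  `(∇²_{X,U} R)(Y,V) ∈ End E`, and its lowered form `apply_cov2RiemAt`;
* **the Ricci identities** (commutation of second covariant derivatives; Topping 2006, (2.1.2),
  (2.1.3): `−R(X,Y) = ∇²_{X,Y} − ∇²_{Y,X}` for his curvature `−R(X,Y)` of ours):
  `IsMetricOn.cov₃At_cov₂At_comm` —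
  `(∇²_{X,A}β)(B,C) − (∇²_{A,X}β)(B,C) = −β(R(X,A)B, C) − β(B, R(X,A)C)`, and
  `IsMetricOn.cov2RiemAt_comm` —
  `(∇²_{X,U}R)(Y,V) − (∇²_{U,X}R)(Y,V) = [R(X,U), R(Y,V)] − R(R(X,U)Y, V) − R(Y, R(X,U)V)`;
* **the differentiated second Bianchi identity** `IsMetricOn.cov2RiemAt_cyclic` —
  `(∇²_{K,W}R)(X,Y) + (∇²_{K,X}R)(Y,W) + (∇²_{K,Y}R)(W,X) = 0` (Topping 2006, proof of
  Prop. 2.4.1, "taking one further derivative" of `∇_i R_{jkla} + ∇_j R_{kila} + ∇_k R_{ijla} = 0`).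

Everything is by direct Fréchet calculus on constant fields: the second derivatives cancel by
symmetry, the Christoffel terms regroup by torsion-freeness and the Jacobi identity in `End E`.
Everything is proved; no definition of `Prop` type is introduced.

## References

* P. Topping, *Lectures on the Ricci flow*, LMS Lecture Note Series 325, CUP 2006: §2.1
  ((2.1.2)–(2.1.3), the Ricci identity; `∇²`), §2.4, Prop. 2.4.1 and its proof (p. 32).
  [Topping2006]
* R. S. Hamilton, *Three-manifolds with positive Ricci curvature*, J. Differential Geom. 17
  (1982), §7, Lemma 7.2. [Hamilton1982]
* B. O'Neill, *Semi-Riemannian geometry with applications to relativity*, Academic Press 1983,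
  Ch. 2, Prop. 2.13 (covariant differential of tensors); Ch. 3, Prop. 3.37. [ONeill1983]
-/

noncomputable section

set_option maxSynthPendingDepth 3

open Set Filter ContinuousLinearMap Module
open scoped Topology ContDiff

namespace Literature.Geometry.Lorentzian

namespace MetricCoord

variable {E : Type*} [NormedAddCommGroup E] [NormedSpace ℝ E]

/-! ### The curvature endomorphism as a bundled bilinear map -/

section Flip

variable {F₁ F₂ F₃ : Type*} [NormedAddCommGroup F₁] [NormedSpace ℝ F₁] [NormedAddCommGroup F₂]
  [NormedSpace ℝ F₂] [NormedAddCommGroup F₃] [NormedSpace ℝ F₃]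

/-- Flipping the two arguments of a field of continuous bilinear maps preserves smoothness.
[folklore] -/
theorem _root_.ContDiffOn.clm_flip {f : E → F₁ →L[ℝ] F₂ →L[ℝ] F₃} {s : Set E} {n : WithTop ℕ∞}
    (hf : ContDiffOn ℝ n f s) : ContDiffOn ℝ n (fun y ↦ (f y).flip) s :=
  (ContinuousLinearMap.flipₗᵢ ℝ F₁ F₂ F₃).contDiff.comp_contDiffOn hf

end Flip

section RiemCLM

variable (G : E → E →L[ℝ] E →L[ℝ] ℝ)

/-- The product term `(X, Y) ↦ Γ_X ∘ Γ_Y` of the curvature, bundled as a continuous bilinear map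
into `End E`. [folklore] -/
def chrCompCLM (x : E) : E →L[ℝ] E →L[ℝ] E →L[ℝ] E :=
  ((((ContinuousLinearMap.compL ℝ E E E).comp (chrAt G x)).flip).comp (chrAt G x)).flip

/-- Unfolding lemma: `chrCompCLM G x X Y = Γ_X ∘ Γ_Y`. [folklore] -/
@[simp]
theorem chrCompCLM_apply (x X Y : E) :
    chrCompCLM G x X Y = (chrAt G x X).comp (chrAt G x Y) := rfl

/-- **The curvature endomorphism, bundled**: `riemCLM G x : E →L E →L End E`,
`(X, Y) ↦ R_x(X,Y) = D_XΓ_Y − D_YΓ_X + Γ_X Γ_Y − Γ_Y Γ_X` (O'Neill 1983, Ch. 3, Lemma 3.38; the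
bilinear map whose values are `riemAt G x X Y`, `riemCLM_apply`). [cite: ONeill1983, Ch. 3, Lemma 3.38] -/
def riemCLM (x : E) : E →L[ℝ] E →L[ℝ] E →L[ℝ] E :=
  fderiv ℝ (chrAt G) x - (fderiv ℝ (chrAt G) x).flip + chrCompCLM G x - (chrCompCLM G x).flip

/-- `riemCLM G x X Y = R_x(X, Y)`. [cite: ONeill1983, Ch. 3, Lemma 3.38] -/
@[simp]
theorem riemCLM_apply (x X Y : E) : riemCLM G x X Y = riemAt G x X Y := by
  simp only [riemCLM, riemAt, _root_.sub_apply, _root_.add_apply, flip_apply, chrCompCLM_apply]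

variable {G} {V : Set E} {x : E} [CompleteSpace E]

/-- The product term is `C^∞` on `V`. [folklore] -/
theorem IsMetricOn.contDiffOn_chrCompCLM (hG : IsMetricOn G V) :
    ContDiffOn ℝ ∞ (chrCompCLM G) V := by
  have hΓ := hG.contDiffOn_chrAt
  have h1 : ContDiffOn ℝ ∞ (fun y ↦ (ContinuousLinearMap.compL ℝ E E E).comp (chrAt G y)) V :=
    (ContinuousLinearMap.compL ℝ E (E →L[ℝ] E) ((E →L[ℝ] E) →L[ℝ] (E →L[ℝ] E))
      (ContinuousLinearMap.compL ℝ E E E)).contDiff.comp_contDiffOn hΓ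
  have h2 : ContDiffOn ℝ ∞ (fun y ↦ ((ContinuousLinearMap.compL ℝ E E E).comp (chrAt G y)).flip) V :=
    h1.clm_flip
  have h3 : ContDiffOn ℝ ∞
      (fun y ↦ (((ContinuousLinearMap.compL ℝ E E E).comp (chrAt G y)).flip).comp (chrAt G y)) V :=
    h2.clm_comp hΓ
  exact h3.clm_flip

/-- **The bundled curvature is smooth**: `x ↦ riemCLM G x` is `C^∞` on `V`. [folklore] -/
theorem IsMetricOn.contDiffOn_riemCLM (hG : IsMetricOn G V) : ContDiffOn ℝ ∞ (riemCLM G) V := by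
  have hD : ContDiffOn ℝ ∞ (fderiv ℝ (chrAt G)) V :=
    hG.contDiffOn_chrAt.fderiv_of_isOpen hG.isOpen (by simp)
  have hDf : ContDiffOn ℝ ∞ (fun y ↦ (fderiv ℝ (chrAt G) y).flip) V := hD.clm_flip
  have hP := hG.contDiffOn_chrCompCLM
  have hPf : ContDiffOn ℝ ∞ (fun y ↦ (chrCompCLM G y).flip) V := hP.clm_flip
  unfold riemCLM
  exact ((hD.sub hDf).add hP).sub hPf

/-- `riemCLM G` is `C^∞` at the points of `V`. [folklore] -/
theorem IsMetricOn.contDiffAt_riemCLM (hG : IsMetricOn G V) (hx : x ∈ V) :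
    ContDiffAt ℝ ∞ (riemCLM G) x :=
  (hG.contDiffOn_riemCLM x hx).contDiffAt (hG.mem_nhds hx)

/-- `riemCLM G` is differentiable at the points of `V`. [folklore] -/
theorem IsMetricOn.differentiableAt_riemCLM (hG : IsMetricOn G V) (hx : x ∈ V) :
    DifferentiableAt ℝ (riemCLM G) x :=
  (hG.contDiffAt_riemCLM hx).differentiableAt (by simp)

/-- `D(riemCLM G)` is differentiable at the points of `V`. [folklore] -/
theorem IsMetricOn.differentiableAt_fderiv_riemCLM (hG : IsMetricOn G V) (hx : x ∈ V) :
    DifferentiableAt ℝ (fderiv ℝ (riemCLM G)) x :=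
  ((hG.contDiffAt_riemCLM hx).fderiv_right (m := ∞) (by simp)).differentiableAt (by simp)

/-- Evaluation commutes with differentiation: `∂_W (R(·)(X,Y))(x) = D(riemCLM G)(x)(W)(X)(Y)`.
[folklore] -/
theorem IsMetricOn.fderiv_riemAt_eq_riemCLM (hG : IsMetricOn G V) (hx : x ∈ V) (X Y W : E) :
    fderiv ℝ (fun y ↦ riemAt G y X Y) x W = fderiv ℝ (riemCLM G) x W X Y := by
  have hR := hG.differentiableAt_riemCLM hx
  have h1 : DifferentiableAt ℝ (fun y ↦ riemCLM G y X) x := differentiableAt_clm_apply_const hR X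
  have heq : (fun y ↦ riemAt G y X Y) = fun y ↦ riemCLM G y X Y := by
    funext y; rw [riemCLM_apply]
  rw [heq, fderiv_clm_apply_const h1 Y W, fderiv_clm_apply_const hR X W]

/-- Symmetry of the second derivative of the bundled curvature: `D²R(X,U) = D²R(U,X)`. [folklore] -/
theorem IsMetricOn.fderiv_fderiv_riemCLM_comm (hG : IsMetricOn G V) (hx : x ∈ V) (X U : E) :
    fderiv ℝ (fderiv ℝ (riemCLM G)) x X U = fderiv ℝ (fderiv ℝ (riemCLM G)) x U X :=
  (hG.contDiffAt_riemCLM hx).isSymmSndFDerivAt two_le_infty X U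

/-- `∂_X (D R(·)(U)(Y)(V))(x) = D²R(x)(X)(U)(Y)(V)`. [folklore] -/
theorem IsMetricOn.fderiv_fderiv_riemCLM_apply (hG : IsMetricOn G V) (hx : x ∈ V) (U Y V X : E) :
    fderiv ℝ (fun y ↦ fderiv ℝ (riemCLM G) y U Y V) x X =
      fderiv ℝ (fderiv ℝ (riemCLM G)) x X U Y V := by
  have hD := hG.differentiableAt_fderiv_riemCLM hx
  have h1 : DifferentiableAt ℝ (fun y ↦ fderiv ℝ (riemCLM G) y U) x :=
    differentiableAt_clm_apply_const hD U
  have h2 : DifferentiableAt ℝ (fun y ↦ fderiv ℝ (riemCLM G) y U Y) x :=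
    differentiableAt_clm_apply_const h1 Y
  rw [fderiv_clm_apply_const h2 V X, fderiv_clm_apply_const h1 Y X, fderiv_clm_apply_const hD U X]

end RiemCLM

/-! ### Covariant derivative of a field of trilinear forms -/

section Cov₃

variable (G : E → E →L[ℝ] E →L[ℝ] ℝ) (τ : E → E →L[ℝ] E →L[ℝ] E →L[ℝ] ℝ)

/-- Correction operator for the first slot of a trilinear form: `(T, Γ_W) ↦ T ∘ Γ_W`, i.e.
`(A,B,C) ↦ T(Γ_W A, B, C)`, bundled in `W`. [folklore] -/
def corr₃₁ (x : E) : E →L[ℝ] E →L[ℝ] E →L[ℝ] E →L[ℝ] ℝ :=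
  (ContinuousLinearMap.compL ℝ E E (E →L[ℝ] E →L[ℝ] ℝ) (τ x)).comp (chrAt G x)

/-- Unfolding lemma for `corr₃₁`. [folklore] -/
@[simp]
theorem corr₃₁_apply (x W A B C : E) : corr₃₁ G τ x W A B C = τ x (chrAt G x W A) B C := rfl

/-- Correction operator for the second slot: `(A,B,C) ↦ T(A, Γ_W B, C)`, bundled in `W`.
[folklore] -/
def corr₃₂ (x : E) : E →L[ℝ] E →L[ℝ] E →L[ℝ] E →L[ℝ] ℝ :=
  (swap₁₂ₗ).comp ((ContinuousLinearMap.compL ℝ E E (E →L[ℝ] E →L[ℝ] ℝ) (swap₁₂ (τ x))).comp (chrAt G x))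
where
  /-- `swap₁₂` as a continuous linear map (it is one: `swap₁₂` of `CoordCurvature`). -/
  swap₁₂ₗ : (E →L[ℝ] E →L[ℝ] E →L[ℝ] ℝ) →L[ℝ] (E →L[ℝ] E →L[ℝ] E →L[ℝ] ℝ) := swap₁₂

/-- Unfolding lemma for `corr₃₂`. [folklore] -/
@[simp]
theorem corr₃₂_apply (x W A B C : E) : corr₃₂ G τ x W A B C = τ x A (chrAt G x W B) C := rfl

/-- Correction operator for the third slot: `(A,B,C) ↦ T(A, B, Γ_W C)`, bundled in `W`.
[folklore] -/
def corr₃₃ (x : E) : E →L[ℝ] E →L[ℝ] E →L[ℝ] E →L[ℝ] ℝ :=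
  (swap₂₃ₗ.comp swap₁₂ₗ).comp
    ((ContinuousLinearMap.compL ℝ E E (E →L[ℝ] E →L[ℝ] ℝ) (swap₁₂ (swap₂₃ (τ x)))).comp (chrAt G x))
where
  /-- `swap₁₂` as a continuous linear map. -/
  swap₁₂ₗ : (E →L[ℝ] E →L[ℝ] E →L[ℝ] ℝ) →L[ℝ] (E →L[ℝ] E →L[ℝ] E →L[ℝ] ℝ) := swap₁₂
  /-- `swap₂₃` as a continuous linear map. -/
  swap₂₃ₗ : (E →L[ℝ] E →L[ℝ] E →L[ℝ] ℝ) →L[ℝ] (E →L[ℝ] E →L[ℝ] E →L[ℝ] ℝ) := swap₂₃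

/-- Unfolding lemma for `corr₃₃`. [folklore] -/
@[simp]
theorem corr₃₃_apply (x W A B C : E) : corr₃₃ G τ x W A B C = τ x A B (chrAt G x W C) := rfl

/-- The **covariant derivative of a field of trilinear forms along a constant field**, as a
4-linear map: `(∇τ)_x(W; A, B, C) = ∂_W τ(A,B,C) − τ(Γ(W,A),B,C) − τ(A,Γ(W,B),C) − τ(A,B,Γ(W,C))`
(O'Neill 1983, Ch. 2, Prop. 2.13, the covariant differential of a `(0,3)` tensor, on constant
fields). With `τ = ∇β = cov₂At G β` this is the second covariant derivative
`(∇²_{W,A} β)(B,C)` (Topping 2006, §2.1: `∇²_{X,Y} := ∇_X ∇_Y − ∇_{∇_X Y}`).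
[cite: ONeill1983, Ch. 2, Prop. 2.13] -/
def cov₃At (x : E) : E →L[ℝ] E →L[ℝ] E →L[ℝ] E →L[ℝ] ℝ :=
  fderiv ℝ τ x - corr₃₁ G τ x - corr₃₂ G τ x - corr₃₃ G τ x

/-- Unfolding lemma:
`(∇τ)(W; A,B,C) = ∂_W τ(A,B,C) − τ(Γ(W,A),B,C) − τ(A,Γ(W,B),C) − τ(A,B,Γ(W,C))`.
[cite: ONeill1983, Ch. 2, Prop. 2.13] -/
@[simp]
theorem cov₃At_apply (x W A B C : E) :
    cov₃At G τ x W A B C = fderiv ℝ τ x W A B C - τ x (chrAt G x W A) B C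
      - τ x A (chrAt G x W B) C - τ x A B (chrAt G x W C) := by
  simp only [cov₃At, _root_.sub_apply, corr₃₁_apply, corr₃₂_apply, corr₃₃_apply]

variable {G τ} {x : E}

/-- `cov₃At` only depends on the germ of the field at `x`. [folklore] -/
theorem cov₃At_congr {τ₁ τ₂ : E → E →L[ℝ] E →L[ℝ] E →L[ℝ] ℝ} (h : τ₁ =ᶠ[𝓝 x] τ₂) :
    cov₃At G τ₁ x = cov₃At G τ₂ x := by
  ext W A B C
  simp only [cov₃At_apply, h.fderiv_eq, h.self_of_nhds]

/-- `∇(τ₁ + τ₂) = ∇τ₁ + ∇τ₂`. [folklore] -/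
theorem cov₃At_add {τ₁ τ₂ : E → E →L[ℝ] E →L[ℝ] E →L[ℝ] ℝ} (h₁ : DifferentiableAt ℝ τ₁ x)
    (h₂ : DifferentiableAt ℝ τ₂ x) :
    cov₃At G (fun y ↦ τ₁ y + τ₂ y) x = cov₃At G τ₁ x + cov₃At G τ₂ x := by
  ext W A B C
  simp only [cov₃At_apply, fderiv_fun_add h₁ h₂, _root_.add_apply]
  ring

/-- `∇(τ₁ − τ₂) = ∇τ₁ − ∇τ₂`. [folklore] -/
theorem cov₃At_sub {τ₁ τ₂ : E → E →L[ℝ] E →L[ℝ] E →L[ℝ] ℝ} (h₁ : DifferentiableAt ℝ τ₁ x)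
    (h₂ : DifferentiableAt ℝ τ₂ x) :
    cov₃At G (fun y ↦ τ₁ y - τ₂ y) x = cov₃At G τ₁ x - cov₃At G τ₂ x := by
  ext W A B C
  simp only [cov₃At_apply, fderiv_fun_sub h₁ h₂, _root_.sub_apply]
  ring

/-- `∇(−τ) = −∇τ`. [folklore] -/
theorem cov₃At_neg {τ : E → E →L[ℝ] E →L[ℝ] E →L[ℝ] ℝ} :
    cov₃At G (fun y ↦ -τ y) x = -cov₃At G τ x := by
  ext W A B C
  simp only [cov₃At_apply, fderiv_fun_neg, _root_.neg_apply]
  ring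

/-- `∇(c τ) = c ∇τ`. [folklore] -/
theorem cov₃At_const_smul {τ : E → E →L[ℝ] E →L[ℝ] E →L[ℝ] ℝ} (hτ : DifferentiableAt ℝ τ x) (c : ℝ) :
    cov₃At G (fun y ↦ c • τ y) x = c • cov₃At G τ x := by
  ext W A B C
  simp only [cov₃At_apply, fderiv_fun_const_smul hτ, _root_.smul_apply, smul_eq_mul]
  ring

/-- **`∇` commutes with the permutation `swap₁₂` of the slots**:
`∇_W (swap₁₂ τ) = swap₁₂ (∇_W τ)` (the Christoffel corrections are permuted accordingly).
[folklore] -/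
theorem cov₃At_swap₁₂ {τ : E → E →L[ℝ] E →L[ℝ] E →L[ℝ] ℝ} (hτ : DifferentiableAt ℝ τ x)
    (W A B C : E) :
    cov₃At G (fun y ↦ swap₁₂ (τ y)) x W A B C = cov₃At G τ x W B A C := by
  have hd : fderiv ℝ (fun y ↦ swap₁₂ (τ y)) x = (swap₁₂ (E := E)).comp (fderiv ℝ τ x) :=
    ((swap₁₂ (E := E)).hasFDerivAt.comp x hτ.hasFDerivAt).fderiv
  simp only [cov₃At_apply, hd, ContinuousLinearMap.comp_apply, swap₁₂_apply]
  ring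

/-- **`∇` commutes with the permutation `swap₂₃` of the slots**:
`∇_W (swap₂₃ τ) = swap₂₃ (∇_W τ)`. [folklore] -/
theorem cov₃At_swap₂₃ {τ : E → E →L[ℝ] E →L[ℝ] E →L[ℝ] ℝ} (hτ : DifferentiableAt ℝ τ x)
    (W A B C : E) :
    cov₃At G (fun y ↦ swap₂₃ (τ y)) x W A B C = cov₃At G τ x W A C B := by
  have hd : fderiv ℝ (fun y ↦ swap₂₃ (τ y)) x = (swap₂₃ (E := E)).comp (fderiv ℝ τ x) :=
    ((swap₂₃ (E := E)).hasFDerivAt.comp x hτ.hasFDerivAt).fderiv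
  simp only [cov₃At_apply, hd, ContinuousLinearMap.comp_apply, swap₂₃_apply]
  ring

end Cov₃

/-! ### The Ricci identity for fields of bilinear forms -/

section RicciBilin

variable [CompleteSpace E] {G : E → E →L[ℝ] E →L[ℝ] ℝ} {V : Set E} {x : E}
  {β : E → E →L[ℝ] E →L[ℝ] ℝ}

/-- The bundled covariant derivative `y ↦ (∇β)_y` of a `C^∞` field of bilinear forms is
differentiable. [folklore] -/
theorem IsMetricOn.differentiableAt_cov₂At (hG : IsMetricOn G V) (hx : x ∈ V)
    (hβ : ContDiffAt ℝ ∞ β x) : DifferentiableAt ℝ (cov₂At G β) x := by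
  have hb : DifferentiableAt ℝ β x := hβ.differentiableAt (by simp)
  have hDb : DifferentiableAt ℝ (fderiv ℝ β) x :=
    (hβ.fderiv_right (m := ∞) (by simp)).differentiableAt (by simp)
  have hΓ := hG.differentiableAt_chrAt hx
  have h1 : DifferentiableAt ℝ
      (fun y ↦ (ContinuousLinearMap.compL ℝ E E (E →L[ℝ] ℝ) (β y)).comp (chrAt G y)) x :=
    (((ContinuousLinearMap.compL ℝ E E (E →L[ℝ] ℝ)).differentiableAt).comp x hb).clm_comp hΓ
  have hflip : DifferentiableAt ℝ (fun y ↦ (β y).flip) x :=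
    ((flipCLM (E := E)).differentiableAt).comp x hb
  have h2 : DifferentiableAt ℝ
      (fun y ↦ (ContinuousLinearMap.compL ℝ E E (E →L[ℝ] ℝ) (β y).flip).comp (chrAt G y)) x :=
    (((ContinuousLinearMap.compL ℝ E E (E →L[ℝ] ℝ)).differentiableAt).comp x hflip).clm_comp hΓ
  have h3 : DifferentiableAt ℝ
      (fun y ↦ flipCLM.comp ((ContinuousLinearMap.compL ℝ E E (E →L[ℝ] ℝ) (β y).flip).comp
        (chrAt G y))) x :=
    ((ContinuousLinearMap.compL ℝ E (E →L[ℝ] E →L[ℝ] ℝ) (E →L[ℝ] E →L[ℝ] ℝ) flipCLM).differentiableAt).comp x h2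
  unfold cov₂At
  exact (hDb.sub h1).sub h3

/-- **The derivative of the components of `∇β`**:
`∂_X ((∇β)(A;B,C)) = D²β(X,A)(B,C) − Dβ(X)(Γ(A,B),C) − β(DΓ(X)(A,B),C) − Dβ(X)(B,Γ(A,C)) − β(B,DΓ(X)(A,C))`
(product and chain rules). [folklore] -/
theorem IsMetricOn.fderiv_cov₂At_apply (hG : IsMetricOn G V) (hx : x ∈ V) (hβ : ContDiffAt ℝ ∞ β x)
    (A B C X : E) :
    fderiv ℝ (cov₂At G β) x X A B C =
      fderiv ℝ (fderiv ℝ β) x X A B C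
        - (fderiv ℝ β x X (chrAt G x A B) C + β x (fderiv ℝ (chrAt G) x X A B) C)
        - (fderiv ℝ β x X B (chrAt G x A C) + β x B (fderiv ℝ (chrAt G) x X A C)) := by
  have hb : DifferentiableAt ℝ β x := hβ.differentiableAt (by simp)
  have hDb : DifferentiableAt ℝ (fderiv ℝ β) x :=
    (hβ.fderiv_right (m := ∞) (by simp)).differentiableAt (by simp)
  have hΓ := hG.differentiableAt_chrAt hx
  have hcov := hG.differentiableAt_cov₂At hx hβ
  -- evaluation commutes with differentiation
  have hev : fderiv ℝ (cov₂At G β) x X A B C = fderiv ℝ (fun y ↦ cov₂At G β y A B C) x X := by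
    have h1 : DifferentiableAt ℝ (fun y ↦ cov₂At G β y A) x := differentiableAt_clm_apply_const hcov A
    have h2 : DifferentiableAt ℝ (fun y ↦ cov₂At G β y A B) x := differentiableAt_clm_apply_const h1 B
    rw [fderiv_clm_apply_const h2 C X, fderiv_clm_apply_const h1 B X, fderiv_clm_apply_const hcov A X]
  rw [hev]
  simp only [cov₂At_apply]
  -- the three summands
  have hd1 : HasFDerivAt (fun y ↦ fderiv ℝ β y A B C)
      ((((fderiv ℝ (fderiv ℝ β) x).flip A).flip B).flip C) x :=
    hasFDerivAt_clm_apply_const (hasFDerivAt_clm_apply_const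
      (hasFDerivAt_clm_apply_const hDb.hasFDerivAt A) B) C
  have hcA : ∀ D : E, HasFDerivAt (fun y ↦ chrAt G y A D) (((fderiv ℝ (chrAt G) x).flip A).flip D) x :=
    fun D ↦ hasFDerivAt_clm_apply_const (hasFDerivAt_clm_apply_const hΓ.hasFDerivAt A) D
  have hd2 : HasFDerivAt (fun y ↦ β y (chrAt G y A B) C)
      ((((β x).comp (((fderiv ℝ (chrAt G) x).flip A).flip B) +
        (fderiv ℝ β x).flip (chrAt G x A B))).flip C) x :=
    hasFDerivAt_clm_apply_const (hb.hasFDerivAt.clm_apply (hcA B)) C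
  have hd3 : HasFDerivAt (fun y ↦ β y B (chrAt G y A C))
      (((β x B).comp (((fderiv ℝ (chrAt G) x).flip A).flip C) +
        ((fderiv ℝ β x).flip B).flip (chrAt G x A C))) x :=
    (hasFDerivAt_clm_apply_const hb.hasFDerivAt B).clm_apply (hcA C)
  rw [((hd1.fun_sub hd2).fun_sub hd3).fderiv]
  simp only [_root_.sub_apply, _root_.add_apply, flip_apply, ContinuousLinearMap.comp_apply]
  ring

/-- **The Ricci identity for a field of bilinear forms** (Topping 2006, (2.1.3) with (2.1.2):
`R(X,Y)β = ∇²_{Y,X}β − ∇²_{X,Y}β` for his curvature `−R` of ours, on a `(0,2)` tensor): for `β`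
of class `C^∞` near `x`,
`(∇²_{X,A}β)(B,C) − (∇²_{A,X}β)(B,C) = −β(R(X,A)B, C) − β(B, R(X,A)C)`,
where `(∇²_{X,A}β)(B,C) = cov₃At G (cov₂At G β) x X A B C`. Direct computation: the second
derivatives of `β` cancel by symmetry, the first derivatives cancel in pairs, and the Christoffel
terms assemble into `R(X,A) = D_XΓ_A − D_AΓ_X + Γ_XΓ_A − Γ_AΓ_X` by torsion-freeness.
[cite: Topping2006, §2.1, (2.1.2)–(2.1.3)] -/
theorem IsMetricOn.cov₃At_cov₂At_comm (hG : IsMetricOn G V) (hx : x ∈ V) (hβ : ContDiffAt ℝ ∞ β x)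
    (X A B C : E) :
    cov₃At G (cov₂At G β) x X A B C - cov₃At G (cov₂At G β) x A X B C =
      -(β x (riemAt G x X A B) C) - β x B (riemAt G x X A C) := by
  simp only [cov₃At_apply, hG.fderiv_cov₂At_apply hx hβ, cov₂At_apply, riemAt_apply, map_sub,
    map_add, _root_.sub_apply, _root_.add_apply]
  have h2 : fderiv ℝ (fderiv ℝ β) x X A = fderiv ℝ (fderiv ℝ β) x A X :=
    hβ.isSymmSndFDerivAt two_le_infty X A
  rw [h2, hG.chrAt_comm hx A X]
  ring

end RicciBilin

/-! ### The second covariant derivative of the curvature endomorphism -/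

section Cov2Riem

variable (G : E → E →L[ℝ] E →L[ℝ] ℝ)

/-- The **second covariant derivative of the curvature endomorphism along constant fields**:
`(∇²_{X,U} R)_x(Y,V) = ∂_X ((∇_U R)(Y,V)) + [Γ_X, (∇_U R)(Y,V)] − (∇_{Γ(X,U)} R)(Y,V)
  − (∇_U R)(Γ(X,Y),V) − (∇_U R)(Y,Γ(X,V)) ∈ End E`
(`∇²_{X,U} = ∇_X∇_U − ∇_{∇_X U}` applied to the `(1,3)` tensor `R`; Topping 2006, §2.1 and the
proof of Prop. 2.4.1, `∇_i∇_j R_{kila}`). [cite: Topping2006, §2.1] -/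
def cov2RiemAt (x X U Y V : E) : E →L[ℝ] E :=
  fderiv ℝ (fun y ↦ covRiemAt G y U Y V) x X + (chrAt G x X).comp (covRiemAt G x U Y V)
    - (covRiemAt G x U Y V).comp (chrAt G x X) - covRiemAt G x (chrAt G x X U) Y V
    - covRiemAt G x U (chrAt G x X Y) V - covRiemAt G x U Y (chrAt G x X V)

/-- Unfolding lemma for `cov2RiemAt`. [cite: Topping2006, §2.1] -/
theorem cov2RiemAt_def (x X U Y V : E) :
    cov2RiemAt G x X U Y V =
      fderiv ℝ (fun y ↦ covRiemAt G y U Y V) x X + (chrAt G x X).comp (covRiemAt G x U Y V)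
        - (covRiemAt G x U Y V).comp (chrAt G x X) - covRiemAt G x (chrAt G x X U) Y V
        - covRiemAt G x U (chrAt G x X Y) V - covRiemAt G x U Y (chrAt G x X V) := rfl

variable {G} {V : Set E} {x : E} [CompleteSpace E]

/-- `∇R` written with the bundled curvature: on `V`,
`(∇_U R)(Y,V) = DR(U)(Y,V) + Γ_U R(Y,V) − R(Y,V) Γ_U − R(Γ(U,Y),V) − R(Y,Γ(U,V))` with
`DR = D(riemCLM G)`. [cite: ONeill1983, Ch. 3, Prop. 3.37] -/
theorem IsMetricOn.covRiemAt_eq_riemCLM (hG : IsMetricOn G V) (hx : x ∈ V) (U Y V : E) :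
    covRiemAt G x U Y V = fderiv ℝ (riemCLM G) x U Y V
      + (chrAt G x U).comp (riemCLM G x Y V) - (riemCLM G x Y V).comp (chrAt G x U)
      - riemCLM G x (chrAt G x U Y) V - riemCLM G x Y (chrAt G x U V) := by
  simp only [covRiemAt, hG.fderiv_riemAt_eq_riemCLM hx, riemCLM_apply]

/-- **The derivative of `∇R`** (product and chain rules on the bundled expression):
`∂_X ((∇_U R)(Y,V)) = D²R(X,U)(Y,V) + DΓ(X)(U) R(Y,V) + Γ_U DR(X)(Y,V) − DR(X)(Y,V) Γ_U
  − R(Y,V) DΓ(X)(U) − DR(X)(Γ(U,Y),V) − R(DΓ(X)(U,Y),V) − DR(X)(Y,Γ(U,V)) − R(Y,DΓ(X)(U,V))`.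
[folklore] -/
theorem IsMetricOn.hasFDerivAt_covRiemAt (hG : IsMetricOn G V) (hx : x ∈ V) (U Y V : E) :
    HasFDerivAt (fun y ↦ covRiemAt G y U Y V)
      ((((fderiv ℝ (fderiv ℝ (riemCLM G)) x).flip U).flip Y).flip V
        + ((ContinuousLinearMap.compL ℝ E E E (chrAt G x U)).comp
            (((fderiv ℝ (riemCLM G) x).flip Y).flip V)
          + ((ContinuousLinearMap.compL ℝ E E E).flip (riemCLM G x Y V)).comp
            ((fderiv ℝ (chrAt G) x).flip U))
        - ((ContinuousLinearMap.compL ℝ E E E (riemCLM G x Y V)).comp ((fderiv ℝ (chrAt G) x).flip U)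
          + ((ContinuousLinearMap.compL ℝ E E E).flip (chrAt G x U)).comp
            (((fderiv ℝ (riemCLM G) x).flip Y).flip V))
        - (((riemCLM G x).comp (((fderiv ℝ (chrAt G) x).flip U).flip Y)
          + (fderiv ℝ (riemCLM G) x).flip (chrAt G x U Y)).flip V)
        - ((riemCLM G x Y).comp (((fderiv ℝ (chrAt G) x).flip U).flip V)
          + ((fderiv ℝ (riemCLM G) x).flip Y).flip (chrAt G x U V))) x := by
  have hR := hG.differentiableAt_riemCLM hx
  have hD := hG.differentiableAt_fderiv_riemCLM hx
  have hΓ := hG.differentiableAt_chrAt hx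
  -- the explicit expression near `x`
  have heq : (fun y ↦ covRiemAt G y U Y V) =ᶠ[𝓝 x] fun y ↦ fderiv ℝ (riemCLM G) y U Y V
      + (chrAt G y U).comp (riemCLM G y Y V) - (riemCLM G y Y V).comp (chrAt G y U)
      - riemCLM G y (chrAt G y U Y) V - riemCLM G y Y (chrAt G y U V) :=
    (hG.eventually_mem hx).mono fun y hy ↦ hG.covRiemAt_eq_riemCLM hy U Y V
  refine HasFDerivAt.congr_of_eventuallyEq ?_ heq
  have h1 : HasFDerivAt (fun y ↦ fderiv ℝ (riemCLM G) y U Y V)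
      ((((fderiv ℝ (fderiv ℝ (riemCLM G)) x).flip U).flip Y).flip V) x :=
    hasFDerivAt_clm_apply_const (hasFDerivAt_clm_apply_const
      (hasFDerivAt_clm_apply_const hD.hasFDerivAt U) Y) V
  have hΓU : HasFDerivAt (fun y ↦ chrAt G y U) ((fderiv ℝ (chrAt G) x).flip U) x :=
    hasFDerivAt_clm_apply_const hΓ.hasFDerivAt U
  have hRYV : HasFDerivAt (fun y ↦ riemCLM G y Y V) (((fderiv ℝ (riemCLM G) x).flip Y).flip V) x :=
    hasFDerivAt_clm_apply_const (hasFDerivAt_clm_apply_const hR.hasFDerivAt Y) V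
  have h2 := hΓU.clm_comp hRYV
  have h3 := hRYV.clm_comp hΓU
  have hcU : ∀ D : E, HasFDerivAt (fun y ↦ chrAt G y U D) (((fderiv ℝ (chrAt G) x).flip U).flip D) x :=
    fun D ↦ hasFDerivAt_clm_apply_const hΓU D
  have h4 : HasFDerivAt (fun y ↦ riemCLM G y (chrAt G y U Y) V)
      ((((riemCLM G x).comp (((fderiv ℝ (chrAt G) x).flip U).flip Y)
        + (fderiv ℝ (riemCLM G) x).flip (chrAt G x U Y))).flip V) x :=
    hasFDerivAt_clm_apply_const (hR.hasFDerivAt.clm_apply (hcU Y)) V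
  have h5 : HasFDerivAt (fun y ↦ riemCLM G y Y (chrAt G y U V))
      ((riemCLM G x Y).comp (((fderiv ℝ (chrAt G) x).flip U).flip V)
        + ((fderiv ℝ (riemCLM G) x).flip Y).flip (chrAt G x U V)) x :=
    (hasFDerivAt_clm_apply_const hR.hasFDerivAt Y).clm_apply (hcU V)
  exact (((h1.add h2).sub h3).sub h4).sub h5

/-- `fderiv` form of `hasFDerivAt_covRiemAt`, evaluated along `X`. [folklore] -/
theorem IsMetricOn.fderiv_covRiemAt (hG : IsMetricOn G V) (hx : x ∈ V) (U Y V X : E) :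
    fderiv ℝ (fun y ↦ covRiemAt G y U Y V) x X =
      fderiv ℝ (fderiv ℝ (riemCLM G)) x X U Y V
        + (fderiv ℝ (chrAt G) x X U).comp (riemCLM G x Y V)
        + (chrAt G x U).comp (fderiv ℝ (riemCLM G) x X Y V)
        - (fderiv ℝ (riemCLM G) x X Y V).comp (chrAt G x U)
        - (riemCLM G x Y V).comp (fderiv ℝ (chrAt G) x X U)
        - fderiv ℝ (riemCLM G) x X (chrAt G x U Y) V - riemCLM G x (fderiv ℝ (chrAt G) x X U Y) V
        - fderiv ℝ (riemCLM G) x X Y (chrAt G x U V) - riemCLM G x Y (fderiv ℝ (chrAt G) x X U V) := by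
  rw [(hG.hasFDerivAt_covRiemAt hx U Y V).fderiv]
  simp only [_root_.add_apply, _root_.sub_apply, flip_apply, ContinuousLinearMap.comp_apply,
    ContinuousLinearMap.compL_apply]
  abel

/-- `y ↦ (∇_U R)_y(Y,V)` is differentiable at the points of `V`. [folklore] -/
theorem IsMetricOn.differentiableAt_covRiemAt (hG : IsMetricOn G V) (hx : x ∈ V) (U Y V : E) :
    DifferentiableAt ℝ (fun y ↦ covRiemAt G y U Y V) x :=
  (hG.hasFDerivAt_covRiemAt hx U Y V).differentiableAt

/-- `y ↦ (∇_U R)_y(Y,V)` is `C^∞` on `V`. [folklore] -/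
theorem IsMetricOn.contDiffOn_covRiemAt (hG : IsMetricOn G V) (U Y Z : E) :
    ContDiffOn ℝ ∞ (fun y ↦ covRiemAt G y U Y Z) V := by
  have hR := hG.contDiffOn_riemCLM
  have hD : ContDiffOn ℝ ∞ (fderiv ℝ (riemCLM G)) V := hR.fderiv_of_isOpen hG.isOpen (by simp)
  have hΓ := hG.contDiffOn_chrAt
  have h1 : ContDiffOn ℝ ∞ (fun y ↦ fderiv ℝ (riemCLM G) y U Y Z) V :=
    ((hD.clm_apply contDiffOn_const).clm_apply contDiffOn_const).clm_apply contDiffOn_const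
  have hΓU : ContDiffOn ℝ ∞ (fun y ↦ chrAt G y U) V := hΓ.clm_apply contDiffOn_const
  have hRYZ : ContDiffOn ℝ ∞ (fun y ↦ riemCLM G y Y Z) V :=
    (hR.clm_apply contDiffOn_const).clm_apply contDiffOn_const
  have h4 : ContDiffOn ℝ ∞ (fun y ↦ riemCLM G y (chrAt G y U Y) Z) V :=
    (hR.clm_apply (hΓU.clm_apply contDiffOn_const)).clm_apply contDiffOn_const
  have h5 : ContDiffOn ℝ ∞ (fun y ↦ riemCLM G y Y (chrAt G y U Z)) V :=
    (hR.clm_apply contDiffOn_const).clm_apply (hΓU.clm_apply contDiffOn_const)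
  have h := (((h1.add (hΓU.clm_comp hRYZ)).sub (hRYZ.clm_comp hΓU)).sub h4).sub h5
  exact h.congr fun y hy ↦ hG.covRiemAt_eq_riemCLM hy U Y Z

/-- `∂_X ((∇_U R)(Y,V) Z) = (∂_X (∇_U R)(Y,V)) Z`. [folklore] -/
theorem IsMetricOn.fderiv_covRiemAt_apply (hG : IsMetricOn G V) (hx : x ∈ V) (U Y V Z X : E) :
    fderiv ℝ (fun y ↦ covRiemAt G y U Y V Z) x X = fderiv ℝ (fun y ↦ covRiemAt G y U Y V) x X Z :=
  fderiv_clm_apply_const (hG.differentiableAt_covRiemAt hx U Y V) Z X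

omit [CompleteSpace E] in
/-- `(∇²_{X,U} R)(V, Y) = −(∇²_{X,U} R)(Y, V)`. [cite: ONeill1983, Ch. 3, Prop. 3.36 (1)] -/
theorem cov2RiemAt_swap (x X U Y V : E) : cov2RiemAt G x X U V Y = -cov2RiemAt G x X U Y V := by
  have h : (fun y ↦ covRiemAt G y U V Y) = fun y ↦ -covRiemAt G y U Y V :=
    funext fun y ↦ covRiemAt_swap y U Y V
  simp only [cov2RiemAt, h, fderiv_fun_neg]
  rw [covRiemAt_swap x U Y V, covRiemAt_swap x (chrAt G x X U) Y V,
    covRiemAt_swap x U Y (chrAt G x X V), covRiemAt_swap x U (chrAt G x X Y) V]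
  simp only [_root_.neg_apply, ContinuousLinearMap.comp_neg, ContinuousLinearMap.neg_comp]
  abel

/-- **Lowering commutes with the second covariant derivative**:
`G((∇²_{X,U}R)(Y,V)Z, W) = ∂_X G((∇_UR)(Y,V)Z, W) − G((∇_{Γ(X,U)}R)(Y,V)Z,W) − G((∇_UR)(Γ(X,Y),V)Z,W)
  − G((∇_UR)(Y,Γ(X,V))Z,W) − G((∇_UR)(Y,V)Γ(X,Z),W) − G((∇_UR)(Y,V)Z,Γ(X,W))`
(metric compatibility). [cite: ONeill1983, Ch. 3, p. 86] -/
theorem IsMetricOn.apply_cov2RiemAt (hG : IsMetricOn G V) (hx : x ∈ V) (X U Y V Z W : E) :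
    G x (cov2RiemAt G x X U Y V Z) W =
      fderiv ℝ (fun y ↦ G y (covRiemAt G y U Y V Z) W) x X
        - G x (covRiemAt G x (chrAt G x X U) Y V Z) W - G x (covRiemAt G x U (chrAt G x X Y) V Z) W
        - G x (covRiemAt G x U Y (chrAt G x X V) Z) W - G x (covRiemAt G x U Y V (chrAt G x X Z)) W
        - G x (covRiemAt G x U Y V Z) (chrAt G x X W) := by
  set c : E → E := fun y ↦ covRiemAt G y U Y V Z with hc
  have hcd : HasFDerivAt c ((fderiv ℝ (fun y ↦ covRiemAt G y U Y V) x).flip Z) x :=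
    hasFDerivAt_clm_apply_const (hG.differentiableAt_covRiemAt hx U Y V).hasFDerivAt Z
  have hprod := hasFDerivAt_clm_apply_const ((hG.differentiableAt hx).hasFDerivAt.clm_apply hcd) W
  have hval : fderiv ℝ (fun y ↦ G y (c y) W) x X =
      G x (fderiv ℝ (fun y ↦ covRiemAt G y U Y V) x X Z) W + fderiv ℝ G x X (covRiemAt G x U Y V Z) W := by
    rw [hprod.fderiv]; rfl
  simp only [hc] at hval
  rw [hval, cov2RiemAt_def, hG.fderiv_eq_chrAt hx X (covRiemAt G x U Y V Z) W]
  simp only [map_sub, map_add, _root_.sub_apply, _root_.add_apply, ContinuousLinearMap.comp_apply]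
  ring

/-- **The Ricci identity for the curvature endomorphism** (commutation of second covariant
derivatives of the `(1,3)` curvature tensor; Topping 2006, (2.1.2)–(2.1.3), used in the proof of
Prop. 2.4.1 as `∇_i∇_j R_{kila} − ∇_j∇_i R_{kila} = …`):
`(∇²_{X,U}R)(Y,V) − (∇²_{U,X}R)(Y,V) = R(X,U) ∘ R(Y,V) − R(Y,V) ∘ R(X,U) − R(R(X,U)Y, V) − R(Y, R(X,U)V)`.
Direct computation on constant fields: the second derivatives of `R` cancel by symmetry, the
first derivatives cancel in pairs, the double commutators give `[[Γ_X,Γ_U], R(Y,V)]` by the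
Jacobi identity, and the slot corrections assemble into `R(X,U) = D_XΓ_U − D_UΓ_X + Γ_XΓ_U − Γ_UΓ_X`
by torsion-freeness. [cite: Topping2006, §2.1, (2.1.2)–(2.1.3)] -/
theorem IsMetricOn.cov2RiemAt_comm (hG : IsMetricOn G V) (hx : x ∈ V) (X U Y V : E) :
    cov2RiemAt G x X U Y V - cov2RiemAt G x U X Y V =
      (riemAt G x X U).comp (riemAt G x Y V) - (riemAt G x Y V).comp (riemAt G x X U)
        - riemAt G x (riemAt G x X U Y) V - riemAt G x Y (riemAt G x X U V) := by
  have h2 := hG.fderiv_fderiv_riemCLM_comm hx X U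
  have hc := hG.chrAt_comm hx X U
  simp only [cov2RiemAt_def, hG.fderiv_covRiemAt hx, hG.covRiemAt_eq_riemCLM hx, h2, hc]
  simp only [← riemCLM_apply]
  simp only [riemCLM_apply G x X U, riemAt, map_sub, map_add,
    _root_.sub_apply, _root_.add_apply, ContinuousLinearMap.comp_apply,
    ContinuousLinearMap.comp_add, ContinuousLinearMap.add_comp, ContinuousLinearMap.comp_sub,
    ContinuousLinearMap.sub_comp, ContinuousLinearMap.comp_assoc]
  abel

/-- **The differentiated second Bianchi identity** (Topping 2006, proof of Prop. 2.4.1: "taking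
one further derivative" of `∇_i R_{jkla} + ∇_j R_{kila} + ∇_k R_{ijla} = 0`):
`(∇²_{K,W}R)(X,Y) + (∇²_{K,X}R)(Y,W) + (∇²_{K,Y}R)(W,X) = 0`. Differentiate the second Bianchi
identity `covRiemAt_cyclic` (valid near `x`) along `K`; the Christoffel corrections regroup into
three further instances of the same identity. [cite: Topping2006, Prop. 2.4.1 (proof)] -/
theorem IsMetricOn.cov2RiemAt_cyclic (hG : IsMetricOn G V) (hx : x ∈ V) (K W X Y : E) :
    cov2RiemAt G x K W X Y + cov2RiemAt G x K X Y W + cov2RiemAt G x K Y W X = 0 := by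
  -- the derivative of the (vanishing) cyclic sum
  have hdf : ∀ A B C : E, HasFDerivAt (fun y ↦ covRiemAt G y A B C)
      (fderiv ℝ (fun y ↦ covRiemAt G y A B C) x) x := fun A B C ↦
    (hG.differentiableAt_covRiemAt hx A B C).hasFDerivAt
  have hsumd := ((hdf W X Y).fun_add (hdf X Y W)).fun_add (hdf Y W X)
  have hzero : (fun y ↦ covRiemAt G y W X Y + covRiemAt G y X Y W + covRiemAt G y Y W X) =ᶠ[𝓝 x]
      fun _ ↦ (0 : E →L[ℝ] E) :=
    (hG.eventually_mem hx).mono fun y hy ↦ hG.covRiemAt_cyclic hy W X Y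
  have hD : fderiv ℝ (fun y ↦ covRiemAt G y W X Y) x K + fderiv ℝ (fun y ↦ covRiemAt G y X Y W) x K
      + fderiv ℝ (fun y ↦ covRiemAt G y Y W X) x K = 0 := by
    have h := hsumd.fderiv
    rw [hzero.fderiv_eq, fderiv_fun_const] at h
    have hK := congrArg (fun T : E →L[ℝ] (E →L[ℝ] E) ↦ T K) h
    simp only [Pi.zero_apply, _root_.zero_apply, _root_.add_apply] at hK
    exact hK.symm
  have c0 := hG.covRiemAt_cyclic hx W X Y
  have c1 := hG.covRiemAt_cyclic hx (chrAt G x K W) X Y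
  have c2 := hG.covRiemAt_cyclic hx W (chrAt G x K X) Y
  have c3 := hG.covRiemAt_cyclic hx W X (chrAt G x K Y)
  have cL : (chrAt G x K).comp (covRiemAt G x W X Y + covRiemAt G x X Y W + covRiemAt G x Y W X) = 0 := by
    rw [c0, ContinuousLinearMap.comp_zero]
  have cR : (covRiemAt G x W X Y + covRiemAt G x X Y W + covRiemAt G x Y W X).comp (chrAt G x K) = 0 := by
    rw [c0, ContinuousLinearMap.zero_comp]
  rw [ContinuousLinearMap.comp_add, ContinuousLinearMap.comp_add] at cL
  rw [ContinuousLinearMap.add_comp, ContinuousLinearMap.add_comp] at cR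
  calc cov2RiemAt G x K W X Y + cov2RiemAt G x K X Y W + cov2RiemAt G x K Y W X
      = (fderiv ℝ (fun y ↦ covRiemAt G y W X Y) x K + fderiv ℝ (fun y ↦ covRiemAt G y X Y W) x K
          + fderiv ℝ (fun y ↦ covRiemAt G y Y W X) x K)
        + ((chrAt G x K).comp (covRiemAt G x W X Y) + (chrAt G x K).comp (covRiemAt G x X Y W)
          + (chrAt G x K).comp (covRiemAt G x Y W X))
        - ((covRiemAt G x W X Y).comp (chrAt G x K) + (covRiemAt G x X Y W).comp (chrAt G x K)
          + (covRiemAt G x Y W X).comp (chrAt G x K))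
        - (covRiemAt G x (chrAt G x K W) X Y + covRiemAt G x X Y (chrAt G x K W)
          + covRiemAt G x Y (chrAt G x K W) X)
        - (covRiemAt G x W (chrAt G x K X) Y + covRiemAt G x (chrAt G x K X) Y W
          + covRiemAt G x Y W (chrAt G x K X))
        - (covRiemAt G x W X (chrAt G x K Y) + covRiemAt G x X (chrAt G x K Y) W
          + covRiemAt G x (chrAt G x K Y) W X) := by
        simp only [cov2RiemAt_def]
        abel
    _ = 0 := by
        rw [hD, cL, cR, c1, c2, c3]
        simp

end Cov2Riem

end MetricCoord

end Literature.Geometry.Lorentzian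

end
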